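import Mathlib
import Summits.KontsevichZagierPeriods.Zeta5Search.Certificates.RecordRayChain
import Summits.KontsevichZagierPeriods.Zeta5Search.Certificates.RayC1RaySteps
import Summits.KontsevichZagierPeriods.Zeta5Search.Certificates.RayC1Forms
import HarnessLib

/-!
# The chain rule of the coefficient frame along the calibration ray C1 (fam-tele g17, S4-C1 LITE file L3)

HONEST FRAMING: systematic search; no irrationality claim unless certified.  Exact algebra about the coefficient frame of
Brown–Zudilin's cellular integral along the CALIBRATION ray `a·n`, `a = (18,32,23,30,28,38,43,30)` (`RayC1Forms.aC1`, dual
point `b_n = n·(85;35,32,30,27,25,22,20) = bC1 n`); NOTHING here is a statement about the size of a linear form, a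
denominator, or the arithmetic nature of `ζ(5)`; every exponent attached to C1 in the tree is `< 1`.

**Theorem (`realFrame_chain`).** For every `n ≥ 1`, `T_ℝ(b_{n+1}) = c_n • P̃(n) • T_ℝ(b_n)` with `P̃(n) = Pgen n = adj(Ã(n))·B̃(n)`
the INTEGER PERIOD MATRIX of `RayC1GenericSteps` and the **scalar law** `c_n = cRec n = sA(n) / (det Ã(n) · sB(n)) ≠ 0`
(`cRec_ne`) — the same law as the record ray's (`RecordRayChain.cRec`), for the C1 block order: `B̃(n)·T(b_n) = sB(n)·T(q_n)`
(42 diagonal shifts, then `H`; `transportB'`) and `Ã(n)·T(b_{n+1}) = sA(n)·T(q_n)` (the 106 lowerings `q_n → b_{n+1}` read as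
raises; `transportA'`).  Also: the rational version `frame_chain`, `det T(b_n) ≠ 0` / `det T_ℝ(b_n) ≠ 0`
(`frameMat_bC1_det_ne`, `realFrame_bC1_det_ne`).

Proof = the 149-step period of fam-tele g17 `c1prep/` (memo `MEMO-S4-C1-sizing.md` §7.1; three independent implementations
agree at `n = 1…5`), each step an instance of `RayC1RaySteps.lower_step/ds_step/h_step`; ALL affine side conditions (every
`n ≥ 1`) are discharged by `decide +kernel` (`chainA_chk₁/₂`, `chainB_chk`, `hB_chk`, `ends_chk`).  This is the hypothesis
`hstep` of `RecordRayConnection.frequently_ne_zero_of_window` on C1 (clause (N) in window form, `RayC1Window`) and the input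
of the Apéry-type recursion for C1 (clause (E), cert-1).  Decl names follow `RecordRayChain` inside `…RayC1.Generic`.
-/

namespace Summit.KontsevichZagierPeriods.Zeta5Search.RayC1.Generic

open Finset Matrix
open Summit.KontsevichZagierPeriods.Zeta5Search.DualSeries (InBox)
open Summit.KontsevichZagierPeriods.Zeta5Search.DualSeriesBounds (natB)
open Summit.KontsevichZagierPeriods.Zeta5Search.WedgeDictionary
open Summit.KontsevichZagierPeriods.Zeta5Search.Elimination
open Summit.KontsevichZagierPeriods.Zeta5Search.RecordRay.Connection
open Summit.KontsevichZagierPeriods.Zeta5Search.RecordRay.Generic (chainProd_mul chainScalar map_smul_mul)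

/-! ### 1. The certificates (all side conditions of the 149 steps, every `n ≥ 1`) -/

/-- Kernel check (`decide`): steps `0 … 52` of the A-block pass their checker, for all `ν ≥ 1` (affine tables). -/
theorem chainA_chk₁ : ((List.range 53).all fun k => lowerChk (betaA k) (betaA (k + 1)) (slotA k)) = true := by
  decide +kernel

/-- Kernel check (`decide`): steps `53 … 105` of the A-block pass their checker, for all `ν ≥ 1`. -/
theorem chainA_chk₂ : ((List.range 53).all fun k => lowerChk (betaA (k + 53)) (betaA (k + 53 + 1)) (slotA (k + 53))) = true := by
  decide +kernel

/-- Every step of the A-block passes its checker. -/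
theorem chainA_chk (k : ℕ) (hk : k < 106) : lowerChk (betaA k) (betaA (k + 1)) (slotA k) = true := by
  rcases Nat.lt_or_ge k 53 with h | h
  · exact List.all_eq_true.1 chainA_chk₁ k (List.mem_range.2 h)
  · obtain ⟨j, rfl⟩ : ∃ j, k = j + 53 := ⟨k - 53, by omega⟩
    exact List.all_eq_true.1 chainA_chk₂ j (List.mem_range.2 (by omega))

/-- Kernel check (`decide`): the 42 diagonal shifts of the B-block pass their checker. -/
theorem chainB_chk : ((List.range 42).all fun k => dsChk (betaB k) (betaB (k + 1))) = true := by
  decide +kernel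

/-- Kernel check (`decide`): the closing `H` step of the B-block passes its checker. -/
theorem hB_chk : hChk (betaB 42) (betaB 43) = true := by decide +kernel

/-- Kernel check (`decide`): point and pair-sum checks at the two ends `b_n` (`betaB 0`) and `q_n` (`betaA 106`). -/
theorem ends_chk : (ptChk (betaB 0) && pairChk (betaB 0) && (ptChk (betaA 106) && pairChk (betaA 106))) = true := by
  decide +kernel

/-- The B-block starts at `b_n` (zero offsets). -/
theorem betaB_zero : betaB 0 = [0, 0, 0, 0, 0, 0, 0, 0] := by decide +kernel

/-- The A-block starts at `b_{n+1}` (offsets = the direction). -/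
theorem betaA_zero : betaA 0 = [85, 35, 32, 30, 27, 25, 22, 20] := by decide +kernel

/-- The two blocks meet at the top point `q_n`. -/
theorem betaB_last : betaB 43 = betaA 106 := by decide +kernel

/-! ### 2. The steps and the two transports -/

/-- One certified step of the A-block: `R̃ · T(point) = γ₃ • T(next point)`. -/
theorem stepA {n : ℕ} (hn : 1 ≤ n) (k : ℕ) (hk : k < 106) :
    matA (n : ℚ) k * frameMat (c1Pt (betaA k) n) = sigA (n : ℚ) k • frameMat (c1Pt (betaA (k + 1)) n) :=
  lower_step (chainA_chk k hk) hn

/-- One certified step of the B-block: `M · T(point) = σ • T(next point)` (`D̃S` for `k < 42`, `H̃` at `k = 42`). -/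
theorem stepB {n : ℕ} (hn : 1 ≤ n) (k : ℕ) (hk : k < 43) :
    matB (n : ℚ) k * frameMat (c1Pt (betaB k) n) = sigB (n : ℚ) k • frameMat (c1Pt (betaB (k + 1)) n) := by
  by_cases h42 : k = 42
  · subst h42
    simp only [matB, sigB, if_true]
    exact h_step hB_chk hn
  · simp only [matB, sigB, h42, if_false]
    exact ds_step (List.all_eq_true.1 chainB_chk k (List.mem_range.2 (by omega))) hn

/-- `Ã(n)·T(b_{n+1}) = sA(n)·T(q_n)` (the lowering block, read upward). -/
theorem transportA {n : ℕ} (hn : 1 ≤ n) :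
    prodA (n : ℚ) * frameMat (c1Pt (betaA 0) n) = sA (n : ℚ) • frameMat (c1Pt (betaA 106) n) :=
  chainProd_mul (matA (n : ℚ)) (fun k => frameMat (c1Pt (betaA k) n)) (sigA (n : ℚ)) 106 (fun k hk => stepA hn k hk)

/-- `B̃(n)·T(b_n) = sB(n)·T(q_n)` (the diagonal-shift block with its closing `H`). -/
theorem transportB {n : ℕ} (hn : 1 ≤ n) :
    prodB (n : ℚ) * frameMat (c1Pt (betaB 0) n) = sB (n : ℚ) • frameMat (c1Pt (betaB 43) n) :=
  chainProd_mul (matB (n : ℚ)) (fun k => frameMat (c1Pt (betaB k) n)) (sigB (n : ℚ)) 43 (fun k hk => stepB hn k hk)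

/-! ### 3. The end points are the C1 points -/

/-- `bC1 n` is the C1 point with zero offsets at `ν = n`. -/
theorem bC1_eq_c1Pt (m : ℕ) : bC1 m = c1Pt [0, 0, 0, 0, 0, 0, 0, 0] m := by
  funext j
  rcases Nat.lt_or_ge j 8 with hj | hj
  · interval_cases j <;> simp [bC1, natB, BC1E, βC1, c1Pt, c1Dir]
  · have h0 : j ≠ 0 := by omega
    have h7 : ¬ j ≤ 7 := by omega
    have hr : c1Dir.length ≤ j := by simp [c1Dir]; omega
    have hz : ([0, 0, 0, 0, 0, 0, 0, 0] : List ℤ).length ≤ j := by simp; omega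
    simp [bC1, natB, c1Pt, h0, h7, List.getElem?_eq_none hr, List.getElem?_eq_none hz]

/-- The start of the A-block is the NEXT C1 point `b_{n+1}`. -/
theorem c1Pt_first (n : ℕ) : c1Pt (betaA 0) n = c1Pt [0, 0, 0, 0, 0, 0, 0, 0] (n + 1) := by
  rw [betaA_zero]
  funext j
  rcases Nat.lt_or_ge j 8 with hj | hj
  · interval_cases j <;> simp [c1Pt, c1Dir] <;> ring
  · have hr : c1Dir.length ≤ j := by simp [c1Dir]; omega
    have hz : ([0, 0, 0, 0, 0, 0, 0, 0] : List ℤ).length ≤ j := by simp; omega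
    have hl : ([85, 35, 32, 30, 27, 25, 22, 20] : List ℤ).length ≤ j := by simp; omega
    simp [c1Pt, List.getElem?_eq_none hr, List.getElem?_eq_none hz, List.getElem?_eq_none hl]

/-- Transport of the frame along the whole A-block: `Ã(n)·T(b_{n+1}) = sA(n)·T(q_n)`. -/
theorem transportA' {n : ℕ} (hn : 1 ≤ n) :
    prodA (n : ℚ) * frameMat (bC1 (n + 1)) = sA (n : ℚ) • frameMat (c1Pt (betaA 106) n) := by
  rw [bC1_eq_c1Pt, ← c1Pt_first]; exact transportA hn

/-- Transport of the frame along the whole B-block: `B̃(n)·T(b_n) = sB(n)·T(q_n)`. -/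
theorem transportB' {n : ℕ} (hn : 1 ≤ n) :
    prodB (n : ℚ) * frameMat (bC1 n) = sB (n : ℚ) • frameMat (c1Pt (betaA 106) n) := by
  rw [bC1_eq_c1Pt, ← betaB_zero, ← betaB_last]; exact transportB hn

/-! ### 4. Non-vanishing of the scalars -/

/-- The A-block scalar does not vanish for `ν ≥ 1`. -/
theorem sA_ne {n : ℕ} (hn : 0 < n) : sA (n : ℚ) ≠ 0 := by
  rw [sA, chainScalar, Ne, List.prod_eq_zero_iff, List.mem_map]
  rintro ⟨k, hk, h0⟩
  exact gamma3_ne (ptChk_of_lowerChk (chainA_chk k (List.mem_range.1 hk))) hn h0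

/-- The B-block scalar does not vanish for `ν ≥ 1`. -/
theorem sB_ne {n : ℕ} (hn : 0 < n) : sB (n : ℚ) ≠ 0 := by
  rw [sB, chainScalar, Ne, List.prod_eq_zero_iff, List.mem_map]
  rintro ⟨k, hk, h0⟩
  by_cases h42 : k = 42
  · subst h42
    simp only [sigB, if_true] at h0
    exact hScale_det_ne (ptChk_of_hChk hB_chk) (prChk_of_hChk hB_chk) hn h0
  · simp only [sigB, h42, if_false] at h0
    have hk' : k ∈ List.range 42 := List.mem_range.2 (by have := List.mem_range.1 hk; omega)
    exact gamma3_ne (ptChk_of_dsChk (List.all_eq_true.1 chainB_chk k hk')) hn h0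

/-- The coefficient frame at `bC1 n` is invertible (`n ≥ 1`). -/
theorem frameMat_bC1_det_ne {m : ℕ} (hm : 1 ≤ m) : (frameMat (bC1 m)).det ≠ 0 := by
  have h := ends_chk
  simp only [Bool.and_eq_true] at h
  rw [bC1_eq_c1Pt, ← betaB_zero]
  exact frameMat_det_ne h.1.1 h.1.2 hm

/-- The coefficient frame at the top point `q_n` is invertible (`n ≥ 1`). -/
theorem frameMat_top_det_ne {n : ℕ} (hn : 1 ≤ n) : (frameMat (c1Pt (betaA 106) n)).det ≠ 0 := by
  have h := ends_chk
  simp only [Bool.and_eq_true] at h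
  exact frameMat_det_ne h.2.1 h.2.2 hn

/-- The A-block step product is invertible for `ν ≥ 1`. -/
theorem prodA_det_ne {n : ℕ} (hn : 0 < n) : (prodA (n : ℚ)).det ≠ 0 := by
  have h := congrArg Matrix.det (transportA' hn)
  rw [Matrix.det_mul, Matrix.det_smul, Fintype.card_fin] at h
  intro h0
  rw [h0, zero_mul] at h
  exact mul_ne_zero (pow_ne_zero 3 (sA_ne hn)) (frameMat_top_det_ne hn) h.symm

/-- **The scalar law.** The chain scalar `c_n = sA(n) / (det Ã(n) · sB(n))` — same formula as the record ray's. -/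
noncomputable def cRec (n : ℕ) : ℚ := sA (n : ℚ) / ((prodA (n : ℚ)).det * sB (n : ℚ))

/-- The connection scalar `c_n` does not vanish (`n ≥ 1`). -/
theorem cRec_ne {n : ℕ} (hn : 1 ≤ n) : cRec n ≠ 0 :=
  div_ne_zero (sA_ne hn) (mul_ne_zero (prodA_det_ne hn) (sB_ne hn))

/-! ### 5. The chain rule -/

/-- `(det Ã · sB) • T(b_{n+1}) = sA • P̃(n) • T(b_n)` — integral form, no division. -/
theorem frame_chain_smul {n : ℕ} (hn : 1 ≤ n) :
    ((prodA (n : ℚ)).det * sB (n : ℚ)) • frameMat (bC1 (n + 1)) =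
      sA (n : ℚ) • (Pgen (n : ℚ) * frameMat (bC1 n)) := by
  have h1 := transportA' hn
  have h2 := transportB' hn
  unfold Pgen
  have h3 : (prodA (n : ℚ)).det • frameMat (bC1 (n + 1)) =
      sA (n : ℚ) • ((prodA (n : ℚ)).adjugate * frameMat (c1Pt (betaA 106) n)) := by
    have := congrArg (fun M => (prodA (n : ℚ)).adjugate * M) h1
    rwa [← Matrix.mul_assoc, Matrix.adjugate_mul, smul_mul_assoc, Matrix.one_mul, Matrix.mul_smul] at this
  calc ((prodA (n : ℚ)).det * sB (n : ℚ)) • frameMat (bC1 (n + 1))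
      = sB (n : ℚ) • ((prodA (n : ℚ)).det • frameMat (bC1 (n + 1))) := by rw [smul_smul, mul_comm]
    _ = sA (n : ℚ) • ((prodA (n : ℚ)).adjugate * (sB (n : ℚ) • frameMat (c1Pt (betaA 106) n))) := by
        rw [h3, smul_comm, Matrix.mul_smul]
    _ = sA (n : ℚ) • ((prodA (n : ℚ)).adjugate * prodB (n : ℚ) * frameMat (bC1 n)) := by
        rw [← h2, Matrix.mul_assoc]

/-- **The chain rule (rational frame).** `T(b_{n+1}) = c_n • P̃(n) • T(b_n)`, `n ≥ 1`. -/
theorem frame_chain {n : ℕ} (hn : 1 ≤ n) :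
    frameMat (bC1 (n + 1)) = cRec n • (Pgen (n : ℚ) * frameMat (bC1 n)) := by
  have h := frame_chain_smul hn
  have hne : (prodA (n : ℚ)).det * sB (n : ℚ) ≠ 0 := mul_ne_zero (prodA_det_ne hn) (sB_ne hn)
  calc frameMat (bC1 (n + 1))
      = ((prodA (n : ℚ)).det * sB (n : ℚ))⁻¹ • (((prodA (n : ℚ)).det * sB (n : ℚ)) • frameMat (bC1 (n + 1))) := by
        rw [smul_smul, inv_mul_cancel₀ hne, one_smul]
    _ = cRec n • (Pgen (n : ℚ) * frameMat (bC1 n)) := by rw [h, smul_smul, cRec, div_eq_inv_mul]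

/-! ### 6. The real frame -/

/-- The real frame at `bC1 n` is the cast of the rational frame times `G`. -/
theorem realFrame_bC1 {m : ℕ} (hm : 1 ≤ m) :
    realFrame (bC1 m) = (frameMat (bC1 m)).map ((↑) : ℚ → ℝ) * gMat := by
  have h := ends_chk
  simp only [Bool.and_eq_true] at h
  obtain ⟨Pbox, Pd, -, P7, -⟩ := ptChk_sound h.1.1 hm
  rw [bC1_eq_c1Pt, ← betaB_zero]
  exact realFrame_eq _ Pbox (by linarith) (by linarith)

/-- The real frame at `bC1 n` is invertible (`n ≥ 1`). -/
theorem realFrame_bC1_det_ne {m : ℕ} (hm : 1 ≤ m) : (realFrame (bC1 m)).det ≠ 0 := by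
  have h := ends_chk
  simp only [Bool.and_eq_true] at h
  obtain ⟨Pbox, Pd, -, P7, -⟩ := ptChk_sound h.1.1 hm
  rw [bC1_eq_c1Pt, ← betaB_zero, realFrame_det _ Pbox (by linarith) (by linarith), neg_ne_zero, Rat.cast_ne_zero,
    ← frameMat_det]
  exact frameMat_det_ne h.1.1 h.1.2 hm

/-- **The chain rule (real frame).** `T_ℝ(b_{n+1}) = c_n • P̃(n) • T_ℝ(b_n)` for `n ≥ 1` — hypothesis `hstep` of
`RecordRayConnection.frequently_ne_zero_of_window` on the C1 ray, with `P n = (Pgen n).map (↑)`. -/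
theorem realFrame_chain {n : ℕ} (hn : 1 ≤ n) :
    realFrame (bC1 (n + 1)) = (cRec n : ℝ) • ((Pgen (n : ℚ)).map ((↑) : ℚ → ℝ) * realFrame (bC1 n)) := by
  rw [realFrame_bC1 (by omega : 1 ≤ n + 1), realFrame_bC1 hn, frame_chain hn, map_smul_mul, smul_mul_assoc,
    Matrix.mul_assoc]

end Summit.KontsevichZagierPeriods.Zeta5Search.RayC1.Generic
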